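import Literature.AlgebraicTopology.CharacteristicClasses.LineEulerClassNaturality
import Literature.AlgebraicTopology.CharacteristicClasses.ProjectiveTautologicalBundle
import Literature.AlgebraicTopology.CharacteristicClasses.FibrewiseContinuity
import HarnessLib

/-!
# The Euler class `x = e(γ¹) ∈ H²(ℙ(V))` of the tautological line bundle and its naturality

D. Husemoller, *Fibre Bundles* (3rd ed. 1994), Ch. 17 §2 (the canonical line bundle on `ℂPⁿ⁻¹`
and the class `a` generating `H*(ℂPⁿ⁻¹)`, Thm. 2.3) and §3 Prop. 3.3 (naturality); J. Milnor,
J. Stasheff, *Characteristic Classes* (1974), §14 (`c₁(γ¹)`). For a finite-dimensional complex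
normed space `V` (universe `0`, the universe of `ℂ`) we set

* `tautEuler V R m = e(γ¹(V))(m) ∈ H²(ℙ(V); R)` — the Euler (= first Chern) class of the
  tautological line bundle `γ¹(V) → ℙ(V)` (`ProjectiveTautologicalBundle`, `LineEulerClass`; `ℙ(V)`
  is compact Hausdorff, `instT2Space…`, `instCompactSpace…`);
* **`tautEuler_map`**: for an injective linear map `i : W → V`, `ℙ(i)^* x_V = x_W`
  (`ℙ(i) : ℙ(W) → ℙ(V)`, `projMapC`): the tautological bundle map `γ¹(W) → γ¹(V)`, `(ℓ, w) ↦ (iℓ, iw)`,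
  is a fibrewise isomorphism with continuous total map (`continuous_tautMap`, read in the charts
  `U_φ` of the two tautological bundles), so `LineEulerClassNaturality.eulerClass_bundleMap` applies.

Everything is proved; no named facts.

## References

* D. Husemoller, *Fibre Bundles*, GTM 20, Springer 1994, Ch. 17 §2 Thm. 2.3, §3 Prop. 3.3. [HusemollerFibreBundles1994]
* J. Milnor, J. Stasheff, *Characteristic Classes*, PUP 1974, §14 p. 158. [MilnorStasheff1974]
-/

noncomputable section

open CategoryTheory Function Set Bundle Literature.AlgebraicTopology.SingularHomology
open scoped LinearAlgebra.Projectivization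

namespace Literature.AlgebraicTopology.CharacteristicClasses

variable (V : Type) [NormedAddCommGroup V] [NormedSpace ℂ V] [FiniteDimensional ℂ V]

/-- `ℙ(V)` is Hausdorff for `V` finite-dimensional. [folklore] -/
instance instT2SpaceProjectivizationFD : T2Space (ℙ ℂ V) := t2Space_of_finiteDimensional ℂ V

/-- `ℙ(V)` is compact for `V` finite-dimensional (hence paracompact). [folklore] -/
instance instCompactSpaceProjectivizationFD : CompactSpace (ℙ ℂ V) := compactSpace_of_finiteDimensional ℂ V

/-- The canonical trivialisation of `γ¹(V)` at `b` reads off the coordinate `φ_b`. [folklore] -/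
theorem trivializationAt_taut_apply (b : ℙ ℂ V) (p : TotalSpace ℂ (tautFiber ℂ V)) :
    trivializationAt ℂ (tautFiber ℂ V) b p = (p.1, chartFunctional ℂ V b (p.2 : V)) := rfl

/-- Its local inverse is `(ℓ, t) ↦ (ℓ, t • v_φ(ℓ))`. [folklore] -/
theorem trivializationAt_taut_symm_apply (b : ℙ ℂ V) (q : ℙ ℂ V × ℂ) :
    (trivializationAt ℂ (tautFiber ℂ V) b).toPartialEquiv.symm q =
      ⟨q.1, ⟨q.2 • affineRep ((chartFunctional ℂ V b : V →L[ℂ] ℂ) : Module.Dual ℂ V) q.1,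
        Submodule.smul_mem _ _ (affineRep_mem_submodule _ _)⟩⟩ := rfl

variable (R : Type) [CommRing R]

/-- **`x_V(m) = e(γ¹(V))(m) ∈ H²(ℙ(V); R)`**, the Euler class of the tautological line bundle
(Husemoller's class `a`, up to the universal sign convention of the Thom class).
[cite: HusemollerFibreBundles1994, Ch. 17 §2 Thm. 2.3] -/
def tautEuler (m : R) : singularCohomology R R (ℙ ℂ V) 2 :=
  eulerClass ℂ (tautFiber ℂ V) (Module.finrank_self ℂ) R m

/-! ### Naturality under injective linear maps -/

section LinearMap

variable {V} {W : Type} [NormedAddCommGroup W] [NormedSpace ℂ W] [FiniteDimensional ℂ W] (i : W →ₗ[ℂ] V) (hi : Injective i)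

/-- `ℙ(i) : ℙ(W) → ℙ(V)` as a continuous map. [cite: HusemollerFibreBundles1994, Ch. 17 §2 (2.1)] -/
def projMapC : C(ℙ ℂ W, ℙ ℂ V) :=
  ⟨Projectivization.map i hi, continuous_map i hi (LinearMap.continuous_of_finiteDimensional i)⟩

omit [FiniteDimensional ℂ V] in
/-- `ℙ(i) [w] = [i w]`. [folklore] -/
@[simp]
theorem projMapC_apply (ℓ : ℙ ℂ W) : projMapC i hi ℓ = Projectivization.map i hi ℓ := rfl

omit [FiniteDimensional ℂ V] [FiniteDimensional ℂ W] in
/-- The line `iℓ ⊆ V` is the image of the line `ℓ ⊆ W`. [folklore] -/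
theorem submodule_map_eq (ℓ : ℙ ℂ W) :
    (Projectivization.submodule ℓ).map i = Projectivization.submodule (Projectivization.map i hi ℓ) := by
  induction ℓ using Projectivization.ind with
  | h w hw => rw [Projectivization.submodule_mk, Projectivization.map_mk, Projectivization.submodule_mk,
      Submodule.map_span, image_singleton]

/-- **The tautological bundle map is a fibrewise isomorphism** `ℓ ≅ iℓ`, `w ↦ i w`. [folklore] -/
def tautFiberMap (ℓ : ℙ ℂ W) : tautFiber ℂ W ℓ ≃L[ℂ] tautFiber ℂ V (Projectivization.map i hi ℓ) :=
  LinearEquiv.toContinuousLinearEquiv <|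
    (Submodule.equivMapOfInjective i hi (Projectivization.submodule ℓ)).trans
      (LinearEquiv.ofEq _ _ (submodule_map_eq i hi ℓ))

omit [FiniteDimensional ℂ V] [FiniteDimensional ℂ W] in
/-- On vectors it is `i`. [folklore] -/
@[simp]
theorem coe_tautFiberMap (ℓ : ℙ ℂ W) (w : tautFiber ℂ W ℓ) : ((tautFiberMap i hi ℓ w : tautFiber ℂ V _) : V) = i w := rfl

/-- **The total map `(ℓ, w) ↦ (iℓ, iw) : E(γ¹(W)) → E(γ¹(V))` is continuous** (in the charts
`U_{φ₁} × ℂ → U_{φ₂} × ℂ` it is `(ℓ, t) ↦ φ₂(i(t • v_{φ₁}(ℓ)))`). [cite: HusemollerFibreBundles1994, Ch. 3 §2] -/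
theorem continuous_tautMap : Continuous fun q : TotalSpace ℂ (tautFiber ℂ W) ↦
    (⟨Projectivization.map i hi q.proj, tautFiberMap i hi q.proj q.2⟩ : TotalSpace ℂ (tautFiber ℂ V)) := by
  refine continuous_totalSpace_map (F₁ := ℂ) (F₂ := ℂ) (projMapC i hi).continuous (fun ℓ w ↦ tautFiberMap i hi ℓ w) fun p ↦ ?_
  set χ₁ : W →L[ℂ] ℂ := chartFunctional ℂ W p.proj
  set χ₂ : V →L[ℂ] ℂ := chartFunctional ℂ V (Projectivization.map i hi p.proj)
  change ContinuousAt (fun q : ℙ ℂ W × ℂ ↦ χ₂ (i (q.2 • affineRep ((χ₁ : W →L[ℂ] ℂ) : Module.Dual ℂ W) q.1))) _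
  have hp : p.proj ∈ chartDomain ((χ₁ : W →L[ℂ] ℂ) : Module.Dual ℂ W) := mem_chartDomain_chartFunctional ℂ W p.proj
  have haff : ContinuousAt (fun ℓ : ℙ ℂ W ↦ affineRep ((χ₁ : W →L[ℂ] ℂ) : Module.Dual ℂ W) ℓ)
      (trivializationAt ℂ (tautFiber ℂ W) p.proj p).1 :=
    (continuousOn_affineRep _ χ₁.continuous).continuousAt ((isOpen_chartDomain _ χ₁.continuous).mem_nhds hp)
  exact (χ₂.continuous.comp (LinearMap.continuous_of_finiteDimensional i)).continuousAt.comp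
    (continuousAt_snd.smul (haff.comp continuousAt_fst))

/-- **Naturality of `x = e(γ¹)` under linear injections: `ℙ(i)^* x_V = x_W`.**
[cite: HusemollerFibreBundles1994, Ch. 17 Prop. 3.3] -/
theorem tautEuler_map (m : R) : tautEuler W R m = singularCohomology.map R R (projMapC i hi) 2 (tautEuler V R m) :=
  eulerClass_bundleMap ℂ ℂ (tautFiber ℂ W) (tautFiber ℂ V) (Module.finrank_self ℂ) (Module.finrank_self ℂ) R
    (g := projMapC i hi) (tautFiberMap i hi) (continuous_tautMap i hi) m

end LinearMap

end Literature.AlgebraicTopology.CharacteristicClasses
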